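import Literature.MathematicalPhysics.KineticTheory.ReyBelletThomas2002Lyapunov
import Literature.MathematicalPhysics.KineticTheory.ReyBelletThomas2002SmoothDensity
import Literature.MathematicalPhysics.KineticTheory.ReyBelletThomas2002Coercive
import Literature.MathematicalPhysics.KineticTheory.LangevinChainExpBound
import Mathlib.Analysis.ODE.Gronwall
import HarnessLib

/-!
# Rey-Bellet–Thomas 2002, Lemma 3.5 eq. (26): `T^t e^{θG} ≤ e^{γ Tr(T) θ t} e^{θG}` for every Markov semigroup of `L`

Trunk T-KINETIC (Literature/MathematicalPhysics/KineticTheory). Inline decomposition step for the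
named fact `ReyBelletThomas2002_thm21` (provefact unit). Rey-Bellet–Thomas 2002, Lemma 3.5: "if
`0 < θ < (max{T_L, T_R})⁻¹` … the semigroup `T^t` … satisfies (26)
`T^t exp(θG)(x) ≤ exp(γ Tr(T) θ t) exp(θG(x))`", obtained in print from (28)
`L exp(θG) = γθ exp(θG)(Tr(T) - r(1 - θT)r) ≤ γθ Tr(T) exp(θG)` by Itô/Fatou/Gronwall.

Here (26) is PROVED for EVERY `S : MarkovSemigroupFor (P.rbGenerator Λ N T_L T_R)` (Markov kernels,
Chapman–Kolmogorov, Dynkin's identity on `C_c^∞`) of a chain with smooth potentials whose energy `G`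
has compact sublevel sets (H1), `γ, T_L, T_R ≥ 0`, `0 ≤ θ`, `θT_L, θT_R ≤ 1` — the port of
`LangevinChainExpBound.lean` (CEHR (3.4)) to the extended phase space, reusing its smooth truncated
exponentials `expCutoff θ R`: `L(F_R∘G) ≤ γθ Tr(T) F_R∘G` (`rbGenerator_comp_rbEnergy_le`, from the
identity `rbGenerator_comp_rbEnergy` of `ReyBelletThomas2002Lyapunov.lean`), Dynkin for
`F_R∘G - F_R(2R) ∈ C_c^∞`, Grönwall, and Fatou as `R → ∞`:

* `MarkovSemigroupFor.rb_lintegral_exp_mul_rbEnergy_le` — (26) as a Lebesgue integral, in the exact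
  form of the hypothesis `h26` of `ReyBelletThomas2002Assembly.lean`.

## References

* L. Rey-Bellet, L. E. Thomas, Comm. Math. Phys. 225 (2002) 305–329, Lemma 3.5 eqs. (26), (28).
* R. Khasminskii, *Stochastic Stability of Differential Equations* (2nd ed., 2012), Thm 3.5
  (`E V(X_t) ≤ e^{ct} V(x)` from `LV ≤ cV`). [folklore]
-/

noncomputable section

open MeasureTheory ProbabilityTheory Filter Topology Set intervalIntegral
open scoped ContDiff NNReal ENNReal

namespace Literature.MathematicalPhysics.KineticTheory.HeatConduction

variable {N : ℕ}

namespace OscillatorChain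

variable (P : OscillatorChain)

/-- The energy `G = r²/2 + H` is smooth for smooth potentials. [folklore] -/
theorem contDiff_rbEnergy (hU : ContDiff ℝ ∞ P.U) (hV : ContDiff ℝ ∞ P.V) (N : ℕ) :
    ContDiff ℝ ∞ (P.rbEnergy N) := by
  have hH : ContDiff ℝ ∞ (P.hamiltonian N) := P.contDiff_hamiltonian hU hV N
  have h1 : ContDiff ℝ ∞ fun x : RBPhaseSpace N => x.2.1 := contDiff_fst.comp contDiff_snd
  have h2 : ContDiff ℝ ∞ fun x : RBPhaseSpace N => x.2.2 := contDiff_snd.comp contDiff_snd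
  exact (((h1.pow 2).add (h2.pow 2)).div_const 2).add (hH.comp contDiff_fst)

/-- **`L(F∘G) ≤ θγ(T_L + T_R) F(G)`** for `γ, T_L, T_R ≥ 0`, `θT_L, θT_R ≤ 1`, whenever
`0 ≤ F'(G) ≤ θ F(G)` and `F''(G) ≤ θ F'(G)` at the point: each reservoir term of
`rbGenerator_comp_rbEnergy` is `T_b F'' r_b² + T_b F' - F' r_b² ≤ F'(T_b + (θT_b - 1) r_b²) ≤ F' T_b`.
For `F = e^{θ·}` this is RBT (28) `L e^{θG} ≤ γθ Tr(T) e^{θG}`.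
[cite: ReyBelletThomas2002, Lemma 3.5 proof eq. (28)] -/
theorem rbGenerator_comp_rbEnergy_le (hH : Differentiable ℝ (P.hamiltonian N)) {F F' F'' : ℝ → ℝ}
    (hF : ∀ u, HasDerivAt F (F' u) u) (hF' : ∀ u, HasDerivAt F' (F'' u) u)
    (hγ : 0 ≤ P.γ) {T_L T_R θ : ℝ} (hTL : 0 ≤ T_L) (hTR : 0 ≤ T_R) (hL : θ * T_L ≤ 1)
    (hR : θ * T_R ≤ 1) (Λ : ℝ) (x : RBPhaseSpace N) (h1 : 0 ≤ F' (P.rbEnergy N x))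
    (h2 : F' (P.rbEnergy N x) ≤ θ * F (P.rbEnergy N x))
    (h3 : F'' (P.rbEnergy N x) ≤ θ * F' (P.rbEnergy N x)) :
    P.rbGenerator Λ N T_L T_R (fun y => F (P.rbEnergy N y)) x ≤
      θ * P.γ * (T_L + T_R) * F (P.rbEnergy N x) := by
  rw [P.rbGenerator_comp_rbEnergy hH hF hF']
  set a := F (P.rbEnergy N x)
  set b := F' (P.rbEnergy N x)
  set c := F'' (P.rbEnergy N x)
  have hterm : ∀ (T : ℝ), 0 ≤ T → θ * T ≤ 1 → ∀ p : ℝ,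
      T * (c * p ^ 2 + b) - b * p ^ 2 ≤ b * T := by
    intro T hT hθT p
    have hp : 0 ≤ p ^ 2 := sq_nonneg p
    have e1 : T * (c * p ^ 2) ≤ T * (θ * b * p ^ 2) := by
      refine mul_le_mul_of_nonneg_left ?_ hT
      nlinarith
    nlinarith [mul_nonneg h1 hp, mul_nonneg (sub_nonneg.2 hθT) (mul_nonneg h1 hp)]
  have hT : 0 ≤ T_L + T_R := add_nonneg hTL hTR
  have hsum : T_L * (c * x.2.1 ^ 2 + b) - b * x.2.1 ^ 2 + (T_R * (c * x.2.2 ^ 2 + b) - b * x.2.2 ^ 2) ≤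
      b * (T_L + T_R) := by
    have := hterm T_L hTL hL x.2.1
    have := hterm T_R hTR hR x.2.2
    linarith
  calc P.γ * _ ≤ P.γ * (b * (T_L + T_R)) := mul_le_mul_of_nonneg_left hsum hγ
    _ ≤ P.γ * (θ * a * (T_L + T_R)) := by
        refine mul_le_mul_of_nonneg_left (mul_le_mul_of_nonneg_right h2 hT) hγ
    _ = θ * P.γ * (T_L + T_R) * a := by ring

/-- The generator (13) annihilates constants: `L(f - c) = L f`. [folklore] -/
theorem rbGenerator_sub_const (Λ : ℝ) (N : ℕ) (T_L T_R : ℝ) (f : RBPhaseSpace N → ℝ) (c : ℝ) :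
    P.rbGenerator Λ N T_L T_R (fun y => f y - c) = P.rbGenerator Λ N T_L T_R f := by
  have hQ : ∀ (i : Fin N) (g : RBPhaseSpace N → ℝ), rbPartialQ i (fun y => g y - c) = rbPartialQ i g :=
    fun i g => by funext x; unfold rbPartialQ partialQ; exact deriv_sub_const _
  have hP : ∀ (i : Fin N) (g : RBPhaseSpace N → ℝ), rbPartialP i (fun y => g y - c) = rbPartialP i g :=
    fun i g => by funext x; unfold rbPartialP partialP; exact deriv_sub_const _
  have hL : ∀ g : RBPhaseSpace N → ℝ, partialRL (fun y => g y - c) = partialRL g :=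
    fun g => by funext x; unfold partialRL; exact deriv_sub_const _
  have hR : ∀ g : RBPhaseSpace N → ℝ, partialRR (fun y => g y - c) = partialRR g :=
    fun g => by funext x; unfold partialRR; exact deriv_sub_const _
  funext x
  simp only [rbGenerator, hQ, hP, hL, hR]

end OscillatorChain

/-! ### (26) for every Markov semigroup of `L` -/

namespace MarkovSemigroupFor

section Generic

variable {X : Type*} [MeasurableSpace X] [NormedAddCommGroup X] [NormedSpace ℝ X]
  [OpensMeasurableSpace X] {L : (X → ℝ) → X → ℝ} (S : MarkovSemigroupFor L)

/-- A bounded continuous function is integrable against every transition probability. [folklore] -/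
theorem integrable_kernel_of_norm_le (t : ℝ≥0) (z : X) {g : X → ℝ}
    (hg : Continuous g) {C : ℝ} (hC : ∀ y, ‖g y‖ ≤ C) : Integrable g (S.kernel t z) :=
  (integrable_const C).mono' hg.aestronglyMeasurable (Eventually.of_forall hC)

end Generic

variable {P : OscillatorChain} {Λ : ℝ} {T_L T_R : ℝ} (S : MarkovSemigroupFor (P.rbGenerator Λ N T_L T_R))

/-- **The truncated bound.** For smooth potentials, compact sublevel sets of `G`, `γ, T_L, T_R ≥ 0`,
`0 ≤ θ`, `θT_L, θT_R ≤ 1`, every `S : MarkovSemigroupFor (P.rbGenerator Λ N T_L T_R)` satisfies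
`P_t(F_R∘G)(z) ≤ e^{θγ(T_L+T_R)t} F_R(G(z))` for the truncated exponentials `F_R = expCutoff θ R`:
Dynkin's identity for `F_R∘G - F_R(2R) ∈ C_c^∞`, `L(F_R∘G) ≤ θγ Tr(T) F_R∘G`, and Grönwall.
[cite: ReyBelletThomas2002, Lemma 3.5 eq. (26)] -/
theorem rb_integral_expCutoff_rbEnergy_le (hU : ContDiff ℝ ∞ P.U) (hV : ContDiff ℝ ∞ P.V)
    (hγ : 0 ≤ P.γ) (hTL : 0 ≤ T_L) (hTR : 0 ≤ T_R)
    (hprop : ∀ E : ℝ, IsCompact {x : RBPhaseSpace N | P.rbEnergy N x ≤ E})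
    {θ : ℝ} (hθ : 0 ≤ θ) (hL : θ * T_L ≤ 1) (hR : θ * T_R ≤ 1) {R : ℝ} (hR0 : 0 < R)
    (t : ℝ≥0) (z : RBPhaseSpace N) :
    ∫ y, expCutoff θ R (P.rbEnergy N y) ∂(S.kernel t z) ≤
      Real.exp (θ * P.γ * (T_L + T_R) * t) * expCutoff θ R (P.rbEnergy N z) := by
  -- the truncated Lyapunov function `g = F_R∘G`, its compactly supported shift `u = g - F_R(2R)`
  set G := P.rbEnergy N with hGdef
  set g : RBPhaseSpace N → ℝ := fun y => expCutoff θ R (G y) with hgdef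
  set c : ℝ := expCutoff θ R (2 * R) with hcdef
  set u : RBPhaseSpace N → ℝ := fun y => g y - c with hudef
  set K : ℝ := θ * P.γ * (T_L + T_R) with hKdef
  have hU1 : ContDiff ℝ 1 P.U := hU.of_le (by norm_cast)
  have hV1 : ContDiff ℝ 1 P.V := hV.of_le (by norm_cast)
  have hHs : ContDiff ℝ ∞ (P.hamiltonian N) := P.contDiff_hamiltonian hU hV N
  have hHd : Differentiable ℝ (P.hamiltonian N) := hHs.differentiable (by simp)
  have hGs : ContDiff ℝ ∞ G := P.contDiff_rbEnergy hU hV N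
  have hg_smooth : ContDiff ℝ ∞ g := (contDiff_expCutoff θ R).comp hGs
  have hu_smooth : ContDiff ℝ ∞ u := hg_smooth.sub contDiff_const
  have hu_supp : HasCompactSupport u := by
    refine HasCompactSupport.intro (hprop (2 * R)) fun x hx => ?_
    simp only [mem_setOf_eq, not_le] at hx
    show expCutoff θ R (G x) - c = 0
    rw [expCutoff_of_ge hR0 hx.le, sub_self]
  have hg_nonneg : ∀ y, 0 ≤ g y := fun y => (expCutoff_pos hθ hR0 _).le
  have hg_norm : ∀ y, ‖g y‖ ≤ Real.exp (θ * (2 * R)) := fun y => by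
    rw [Real.norm_of_nonneg (hg_nonneg y)]; exact expCutoff_le_exp_two_mul hθ hR0 _
  have hg_cont : Continuous g := hg_smooth.continuous
  -- `L g = L u` is bounded and continuous, and `L g ≤ K g`
  have hLu : P.rbGenerator Λ N T_L T_R u = P.rbGenerator Λ N T_L T_R g :=
    P.rbGenerator_sub_const Λ N T_L T_R g c
  have hLg_cont : Continuous (P.rbGenerator Λ N T_L T_R g) := by
    rw [← hLu]; exact P.continuous_rbGenerator hU1 hV1 Λ N T_L T_R (hu_smooth.of_le (by norm_cast))
  obtain ⟨C, hC⟩ : ∃ C, ∀ x, ‖P.rbGenerator Λ N T_L T_R g x‖ ≤ C := by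
    obtain ⟨C, hC⟩ := P.exists_bound_rbGenerator hU1 hV1 Λ N T_L T_R (hu_smooth.of_le (by norm_cast))
      hu_supp
    exact ⟨C, fun x => by rw [← hLu]; exact hC x⟩
  have hLg_le : ∀ x, P.rbGenerator Λ N T_L T_R g x ≤ K * g x := fun x =>
    P.rbGenerator_comp_rbEnergy_le hHd (F := expCutoff θ R) (F' := expCutoffDeriv θ R)
      (F'' := deriv (expCutoffDeriv θ R)) (hasDerivAt_expCutoff θ R)
      (fun v => ((hasDerivAt_expCutoffDeriv θ R v).differentiableAt).hasDerivAt) hγ hTL hTR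
      hL hR Λ x (expCutoffDeriv_nonneg hθ _) (expCutoffDeriv_le hθ hR0 _)
      (deriv_expCutoffDeriv_le hθ hR0 _)
  -- the orbit maps `φ(s) = P_s g (z)`, `ψ(s) = P_s (L g)(z)` (`s ≤ 0` read as `s = 0`)
  set φ : ℝ → ℝ := fun s => ∫ y, g y ∂(S.kernel s.toNNReal z) with hφdef
  set ψ : ℝ → ℝ := fun s => ∫ y, P.rbGenerator Λ N T_L T_R g y ∂(S.kernel s.toNNReal z) with hψdef
  have hφ_meas : StronglyMeasurable φ :=
    (S.stronglyMeasurable_uncurry_act hg_cont.stronglyMeasurable).comp_measurable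
      (measurable_const.prodMk measurable_id)
  have hψ_meas : StronglyMeasurable ψ :=
    (S.stronglyMeasurable_uncurry_act hLg_cont.stronglyMeasurable).comp_measurable
      (measurable_const.prodMk measurable_id)
  have hφ_bound : ∀ s, ‖φ s‖ ≤ Real.exp (θ * (2 * R)) := fun s => S.norm_act_le _ hg_norm z
  have hψ_bound : ∀ s, ‖ψ s‖ ≤ C := fun s => S.norm_act_le _ hC z
  have hφ_nonneg : ∀ s, 0 ≤ φ s := fun s => integral_nonneg hg_nonneg
  have hφ_int : ∀ a b, IntervalIntegrable φ volume a b := intervalIntegrable_of_norm_le hφ_meas hφ_bound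
  have hψ_int : ∀ a b, IntervalIntegrable ψ volume a b := intervalIntegrable_of_norm_le hψ_meas hψ_bound
  have hψ_le : ∀ s, ψ s ≤ K * φ s := fun s => by
    calc ψ s ≤ ∫ y, K * g y ∂(S.kernel s.toNNReal z) :=
          integral_mono (S.integrable_kernel_of_norm_le _ z hLg_cont hC)
            ((S.integrable_kernel_of_norm_le _ z hg_cont hg_norm).const_mul K) hLg_le
      _ = K * φ s := integral_const_mul K g
  -- Dynkin's identity for `u`: `φ(s) = g(z) + ∫₀ˢ ψ` for `s ≥ 0`
  have hdyn : ∀ s : ℝ, 0 ≤ s → φ s = g z + ∫ r in (0 : ℝ)..s, ψ r := by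
    intro s hs
    have h := S.dynkin u hu_smooth hu_supp s.toNNReal z
    rw [Real.coe_toNNReal _ hs, hLu] at h
    have hint : ∫ y, u y ∂(S.kernel s.toNNReal z) = φ s - c := by
      simp only [hudef]
      rw [integral_sub (S.integrable_kernel_of_norm_le _ z hg_cont hg_norm) (integrable_const c)]
      simp [hφdef]
    rw [hint] at h
    have hu0 : u z = g z - c := rfl
    rw [hu0] at h
    change φ s = g z + ∫ r in (0 : ℝ)..s, ψ r
    linarith
  have hφ_eq : φ = fun s => g z + ∫ r in (0 : ℝ)..(max s 0), ψ r := by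
    funext s
    rcases le_total 0 s with hs | hs
    · rw [max_eq_left hs]; exact hdyn s hs
    · rw [max_eq_right hs, intervalIntegral.integral_same, add_zero]
      change ∫ y, g y ∂(S.kernel s.toNNReal z) = g z
      rw [Real.toNNReal_of_nonpos hs, kernel_zero_apply, integral_dirac]
  have hφ_cont : Continuous φ := by
    rw [hφ_eq]
    exact continuous_const.add
      ((intervalIntegral.continuous_primitive hψ_int 0).comp (continuous_id.max continuous_const))
  -- Gronwall for `Φ(s) = ∫₀ˢ φ`: `Φ' = φ ≤ g z + K Φ`
  set Φ : ℝ → ℝ := fun s => ∫ r in (0 : ℝ)..s, φ r with hΦdef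
  have hΦ_deriv : ∀ s, HasDerivAt Φ (φ s) s := fun s =>
    (hφ_cont.integral_hasStrictDerivAt 0 s).hasDerivAt
  have hΦ_nonneg : ∀ s, 0 ≤ s → 0 ≤ Φ s := fun s hs =>
    intervalIntegral.integral_nonneg hs fun r _ => hφ_nonneg r
  have hφ_le : ∀ s, 0 ≤ s → φ s ≤ g z + K * Φ s := by
    intro s hs
    rw [hdyn s hs]
    have h1 : ∫ r in (0 : ℝ)..s, ψ r ≤ ∫ r in (0 : ℝ)..s, K * φ r :=
      intervalIntegral.integral_mono_on hs (hψ_int 0 s) ((hφ_int 0 s).const_mul K)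
        fun r _ => hψ_le r
    rw [intervalIntegral.integral_const_mul] at h1
    linarith
  have hGr : ∀ x ∈ Icc (0 : ℝ) t, ‖Φ x‖ ≤ gronwallBound 0 K (g z) (x - 0) := by
    refine norm_le_gronwallBound_of_norm_deriv_right_le (f' := φ)
      (fun x _ => (hΦ_deriv x).continuousAt.continuousWithinAt)
      (fun x _ => (hΦ_deriv x).hasDerivWithinAt) (by simp [hΦdef]) fun x hx => ?_
    rw [Real.norm_of_nonneg (hφ_nonneg x), Real.norm_of_nonneg (hΦ_nonneg x hx.1)]
    linarith [hφ_le x hx.1]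
  have ht0 : (0 : ℝ) ≤ t := t.coe_nonneg
  have hGt := hGr t ⟨ht0, le_rfl⟩
  rw [sub_zero, Real.norm_of_nonneg (hΦ_nonneg t ht0)] at hGt
  -- conclusion
  have hφt : φ t = ∫ y, g y ∂(S.kernel t z) := by
    simp only [hφdef, Real.toNNReal_coe]
  rw [← hφt]
  have hK0 : 0 ≤ K := by
    have : 0 ≤ T_L + T_R := add_nonneg hTL hTR
    positivity
  rcases hK0.eq_or_lt with hK | hK
  · -- `K = 0`
    have := hφ_le t ht0
    rw [← hK] at this ⊢
    simpa using this
  · have hne : K ≠ 0 := hK.ne'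
    rw [gronwallBound_of_K_ne_0 hne] at hGt
    simp only [zero_mul, zero_add] at hGt
    have h1 := hφ_le t ht0
    have h2 : K * Φ t ≤ g z * (Real.exp (K * t) - 1) := by
      calc K * Φ t ≤ K * (g z / K * (Real.exp (K * t) - 1)) := mul_le_mul_of_nonneg_left hGt hK.le
        _ = g z * (Real.exp (K * t) - 1) := by field_simp
    calc φ t ≤ g z + K * Φ t := h1
      _ ≤ g z + g z * (Real.exp (K * t) - 1) := by linarith
      _ = Real.exp (K * t) * g z := by ring

/-- **Rey-Bellet–Thomas 2002, Lemma 3.5 eq. (26) `T^t e^{θG}(x) ≤ e^{γ Tr(T) θ t} e^{θG(x)}`,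
PROVED for every Markov semigroup of `L`** (`S : MarkovSemigroupFor (P.rbGenerator Λ N T_L T_R)`):
for smooth potentials with compact sublevel sets of `G`, `γ, T_L, T_R ≥ 0` and `0 ≤ θ` with
`θT_L, θT_R ≤ 1`, `∫ e^{θG(y)} P_t(x, dy) ≤ e^{γ(T_L+T_R)θt} e^{θG(x)}` (Lebesgue integral). From the
truncated bound by Fatou's lemma. [cite: ReyBelletThomas2002, Lemma 3.5 eq. (26)] -/
theorem rb_lintegral_exp_mul_rbEnergy_le (hU : ContDiff ℝ ∞ P.U) (hV : ContDiff ℝ ∞ P.V)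
    (hγ : 0 ≤ P.γ) (hTL : 0 ≤ T_L) (hTR : 0 ≤ T_R)
    (hprop : ∀ E : ℝ, IsCompact {x : RBPhaseSpace N | P.rbEnergy N x ≤ E})
    {θ : ℝ} (hθ : 0 ≤ θ) (hL : θ * T_L ≤ 1) (hR : θ * T_R ≤ 1) (t : ℝ≥0) (x : RBPhaseSpace N) :
    ∫⁻ y, ENNReal.ofReal (Real.exp (θ * P.rbEnergy N y)) ∂(S.kernel t x) ≤
      ENNReal.ofReal (Real.exp (P.γ * (T_L + T_R) * θ * t) * Real.exp (θ * P.rbEnergy N x)) := by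
  have hGc : Continuous (P.rbEnergy N) := P.continuous_rbEnergy hU.continuous hV.continuous N
  set f : ℕ → RBPhaseSpace N → ℝ≥0∞ := fun n y =>
    ENNReal.ofReal (expCutoff θ (n + 1) (P.rbEnergy N y)) with hfdef
  have hf_meas : ∀ n, Measurable (f n) := fun n =>
    ENNReal.measurable_ofReal.comp ((continuous_expCutoff _ _).comp hGc).measurable
  have hf_tendsto : ∀ y, Tendsto (fun n => f n y) atTop
      (𝓝 (ENNReal.ofReal (Real.exp (θ * P.rbEnergy N y)))) := fun y =>
    (ENNReal.continuous_ofReal.tendsto _).comp (tendsto_expCutoff_atTop θ _)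
  have hKK : P.γ * (T_L + T_R) * θ * t = θ * P.γ * (T_L + T_R) * t := by ring
  calc ∫⁻ y, ENNReal.ofReal (Real.exp (θ * P.rbEnergy N y)) ∂(S.kernel t x)
      = ∫⁻ y, liminf (fun n => f n y) atTop ∂(S.kernel t x) :=
        lintegral_congr fun y => ((hf_tendsto y).liminf_eq).symm
    _ ≤ liminf (fun n => ∫⁻ y, f n y ∂(S.kernel t x)) atTop := lintegral_liminf_le hf_meas
    _ ≤ ENNReal.ofReal (Real.exp (P.γ * (T_L + T_R) * θ * t) * Real.exp (θ * P.rbEnergy N x)) := by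
        refine liminf_le_of_frequently_le' (Eventually.of_forall fun n => ?_).frequently
        have hR0 : (0 : ℝ) < n + 1 := by positivity
        have hint : Integrable (fun y => expCutoff θ (n + 1) (P.rbEnergy N y)) (S.kernel t x) :=
          S.integrable_kernel_of_norm_le t x ((continuous_expCutoff _ _).comp hGc) fun y => by
            rw [Real.norm_of_nonneg (expCutoff_pos hθ hR0 _).le]
            exact expCutoff_le_exp_two_mul hθ hR0 _
        simp only [hfdef]
        rw [← ofReal_integral_eq_lintegral_ofReal hint
          (Eventually.of_forall fun y => (expCutoff_pos hθ hR0 _).le), hKK]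
        refine ENNReal.ofReal_le_ofReal ?_
        exact (S.rb_integral_expCutoff_rbEnergy_le hU hV hγ hTL hTR hprop hθ hL hR hR0 t x).trans
          (mul_le_mul_of_nonneg_left (expCutoff_le_exp hθ hR0 _) (Real.exp_pos _).le)

/-- **(26) in the `h26` form of `ReyBelletThomas2002Assembly.lean`**: under H1 (`RBGrowth`, exponents
`≥ 1`), `γ ≥ 0`, `T_L, T_R > 0`, for every Markov semigroup of `L` and every
`0 < θ < 1/max(T_L, T_R)`. [cite: ReyBelletThomas2002, Lemma 3.5 eq. (26)] -/
theorem rb_h26 {k₁ k₂ : ℝ} (hU : RBGrowth P.U k₁) (hV : RBGrowth P.V k₂) (hk₁ : 1 ≤ k₁) (hk₂ : 1 ≤ k₂)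
    (hγ : 0 ≤ P.γ) (hTL : 0 < T_L) (hTR : 0 < T_R) :
    ∀ θ : ℝ, 0 < θ → θ < 1 / max T_L T_R → ∀ (t : ℝ≥0) (x : RBPhaseSpace N),
      ∫⁻ y, ENNReal.ofReal (Real.exp (θ * P.rbEnergy N y)) ∂(S.kernel t x) ≤
        ENNReal.ofReal (Real.exp (P.γ * (T_L + T_R) * θ * t) * Real.exp (θ * P.rbEnergy N x)) := by
  intro θ hθ hθ' t x
  have hm : 0 < max T_L T_R := lt_max_of_lt_left hTL
  have hθm : θ * max T_L T_R ≤ 1 := ((lt_div_iff₀ hm).1 hθ').le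
  have hL : θ * T_L ≤ 1 := (mul_le_mul_of_nonneg_left (le_max_left _ _) hθ.le).trans hθm
  have hR : θ * T_R ≤ 1 := (mul_le_mul_of_nonneg_left (le_max_right _ _) hθ.le).trans hθm
  exact S.rb_lintegral_exp_mul_rbEnergy_le hU.1 hV.1 hγ hTL.le hTR.le
    (P.isCompact_setOf_rbEnergy_le hU hV hk₁ hk₂ N) hθ.le hL hR t x

end MarkovSemigroupFor

end Literature.MathematicalPhysics.KineticTheory.HeatConduction
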